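import Summits.BirchSwinnertonDyer.BirchSwinnertonDyer.Theorems.KolyvaginRoadThreeSchneiderTamAtThreeHeightLogNumeratorSplitTwoTerm
import Summits.BirchSwinnertonDyer.BirchSwinnertonDyer.Theorems.KolyvaginRoadThreeSchneiderTamAtThreeHeightLogNumeratorSplitThree
import HarnessLib

/-!
# The split `p`-adic height — DIGIT ROW CHECKERS in certificate currency (`RegMult.CertSplit W p Q 1`; `p ≥ 5` and
# `p = 3`) and two digit rows of record at `3` (`170034b1`, `438510e1`)

HONEST FRAMING (cell `bsd-stepL`, seat `bsd-stepL-tam3-p2` g4; `--supports stmt-BirchSwinnertonDyer-19154 --as helper`):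
THEOREMS ONLY; 0 definitions, 0 named facts, 0 sorry; ONE curve per application; nothing class-wide; BSD asserted nowhere.
Imports `…SplitThree` (hence part 4 of the seat's chain and the cone of route `KolyvaginRoadThree` — cone lint known;
the law itself is route-free: `…SplitDigit`, `…SplitTwoTerm`). With `…SplitChecker` ∕ `…SplitThree` (valuation rows:
`α + v_L ≠ v_p(den x)`) these checkers decide EVERY row on which the first digit of the split height is visible:
on lane A's 961 split ∧ (ram) X11b@3 classes that is 416 tabulated points by ≤ 3 integer congruences (297 valuation +
119 digit; the 447 silent points are `3·Q′` artefacts or genuine second-digit cases — evidence SPLIT3-ROWS.tsv on 19154).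

* `certSplit_of_digitRow_padic` — `p ≥ 5`: the digit checker of `…SplitTwoTerm` + the gcd admissibility test ⟹
  `RegMult.CertSplit W p Q 1`.
* `heightSplitCoord_ne_zero_of_digitRow_three`, `certSplit_of_digitRow_three` — the `p = 3` twins (first-order law of
  part 4; `a^{p−1} − 1 = a² − 1`, `N_L = U² − c₄¹²`).
* `certSplit_170034b1`, `certSplit_438510e1` — digit rows of record (type `I₁`, `k = 1`, `α = v_L = 1`).

References: [SteinWuthrich2013] §4.2 (p. 16); [SilvermanAEC2009] VII.2.1; [Iwasawa1972PadicL] §4.4; [Cremona1997] Table 1.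
-/

noncomputable section

open scoped Classical
open Filter Topology IsUltrametricDist
open WeierstrassCurve Literature.NumberTheory.EllipticCurves
open Literature.NumberTheory.EllipticCurves.SteinWuthrich2013
open Literature.NumberTheory.EllipticCurves.TateCurve
open Literature.NumberTheory.EllipticCurves.Rank1Residual
open Summit.BirchSwinnertonDyer.Uniform.UI.O2
open Summit.BirchSwinnertonDyer.Rank1Residual Summit.BirchSwinnertonDyer.Rank1Residual.X11b
open Summit.BirchSwinnertonDyer.BirchSwinnertonDyer.Rank1Residual

namespace Summit.BirchSwinnertonDyer.Rank1Residual.X11b.RegMult.HeightLogNumerator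

/-! ### §11 `p ≥ 5`: the digit checker in certificate currency -/

section DigitPadic

variable {p : ℕ} [Fact p.Prime]

/-- **`RegMult.CertSplit W p Q 1` from the digit row checker** (`p ≥ 5`; hypotheses of
`heightSplitCoord_ne_zero_of_digitRow_padic` + the gcd admissibility test). ONE curve per application.
[cite: SteinWuthrich2013, §4.2] [cite: SilvermanAEC2009, VII.2.1] [cite: MazurSteinTate2006, §1] -/
theorem certSplit_of_digitRow_padic (hp5 : 5 ≤ p) (W : WeierstrassCurve ℚ) {a₁ a₂ a₃ a₄ a₆ : ℤ}
    (hW : W = ⟨a₁, a₂, a₃, a₄, a₆⟩) [W.IsElliptic] [W.IsGloballyMinimal] (hWm : Mult W p)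
    {a b c4 c6 Dp U NL nL m : ℤ} {e' k n ν vL α : ℕ}
    (Hg : Int.gcd (2 * b + a₁ * a * (p ^ k * e' : ℕ) + a₃ * (p ^ k * e' : ℕ) ^ 3)
        (a₁ * b * (p ^ k * e' : ℕ) - (3 * a ^ 2 + 2 * a₂ * a * (p ^ k * e' : ℕ) ^ 2 + a₄ * (p ^ k * e' : ℕ) ^ 4))
        ∣ (p ^ k * e') ^ n)
    (H : ¬ p ∣ e' ∧ 1 ≤ k ∧ Nat.Coprime a.natAbs (p ^ k * e') ∧ ¬ (p : ℤ) ∣ b ∧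
      c4 = (a₁ ^ 2 + 4 * a₂) ^ 2 - 24 * (2 * a₄ + a₁ * a₃) ∧
      c6 = -(a₁ ^ 2 + 4 * a₂) ^ 3 + 36 * (a₁ ^ 2 + 4 * a₂) * (2 * a₄ + a₁ * a₃) - 216 * (a₃ ^ 2 + 4 * a₆) ∧
      (p : ℤ) ^ ν * Dp = -(a₁ ^ 2 + 4 * a₂) ^ 2 * (a₁ ^ 2 * a₆ + 4 * a₂ * a₆ - a₁ * a₃ * a₄ + a₂ * a₃ ^ 2 - a₄ ^ 2) -
        8 * (2 * a₄ + a₁ * a₃) ^ 3 - 27 * (a₃ ^ 2 + 4 * a₆) ^ 2 +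
        9 * (a₁ ^ 2 + 4 * a₂) * (2 * a₄ + a₁ * a₃) * (a₃ ^ 2 + 4 * a₆) ∧
      ¬ (p : ℤ) ∣ c4 ∧ ¬ (p : ℤ) ∣ Dp ∧
      U = Dp * c4 ^ 3 + 744 * (p : ℤ) ^ ν * Dp ^ 2 ∧ NL = U ^ (p - 1) - c4 ^ (6 * (p - 1)) ∧
      NL = (p : ℤ) ^ vL * nL ∧ ¬ (p : ℤ) ∣ nL ∧ 1 ≤ vL ∧ vL + 1 ≤ 2 * ν ∧
      α + vL = 2 * k ∧ (p : ℤ) ^ α * m = a ^ (p - 1) - 1 ∧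
      ¬ (p : ℤ) ∣ m * b ^ 2 * c4 * nL + a ^ 2 * (e' : ℤ) ^ 2 * c6)
    {x y : ℚ} (hx : x = a / ((p ^ k * e' : ℕ) : ℚ) ^ 2) (hy : y = b / ((p ^ k * e' : ℕ) : ℚ) ^ 3)
    (h : W.toAffine.Nonsingular x y) :
    RegMult.CertSplit W p (.some x y h) 1 := by
  have hpP : p.Prime := Fact.out
  have he'0 : e' ≠ 0 := by rintro rfl; exact H.1 (dvd_zero p)
  have he0 : (p ^ k * e' : ℕ) ≠ 0 := Nat.mul_ne_zero (pow_ne_zero _ hpP.ne_zero) he'0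
  have hpe : p ∣ p ^ k * e' := dvd_mul_of_dvd_left (dvd_pow_self p (by have := H.2.1; omega)) _
  have hx1 : 1 < ‖(x : ℚ_[p])‖ :=
    (one_lt_norm_ratCast_iff p x).mpr (KernelCert.padicValRat_x_neg he0 hx H.2.2.1 hpe)
  have hadm : W.IsAdmissible p (.some x y h) :=
    isAdmissible_of_one_lt_norm (by omega) h hx1
      (KernelCert.hasNonsingularReductionAt_of_gcd W hW he0 hx hy H.2.2.1 Hg)
  refine ⟨by rw [one_nsmul]; exact hadm, fun Dq => ?_⟩
  rw [one_nsmul]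
  show heightSplitCoord W p Dq.q x y ≠ 0
  exact heightSplitCoord_ne_zero_of_digitRow_padic hp5 W hW hWm H hx hy h.left Dq.q_ne_zero Dq.norm_q_lt_one
    Dq.tateJ_eq

end DigitPadic

/-! ### §12 `p = 3`: the digit checker -/

section DigitThree

/-- **FIRST-DIGIT SPLIT ROW CHECKER at `p = 3` (value form)**: as `heightSplitCoord_ne_zero_of_digitRow_padic` with the
`3`-adic first-order law of part 4. [cite: SteinWuthrich2013, §4.2] [cite: Iwasawa1972PadicL, §4.4] -/
theorem heightSplitCoord_ne_zero_of_digitRow_three (W : WeierstrassCurve ℚ) {a₁ a₂ a₃ a₄ a₆ : ℤ}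
    (hW : W = ⟨a₁, a₂, a₃, a₄, a₆⟩) [W.IsElliptic] [W.IsGloballyMinimal] (hWm : Mult W 3)
    {a b c4 c6 Dp U NL nL m : ℤ} {e' k ν vL α : ℕ}
    (H : ¬ 3 ∣ e' ∧ 1 ≤ k ∧ Nat.Coprime a.natAbs (3 ^ k * e') ∧ ¬ (3 : ℤ) ∣ b ∧
      c4 = (a₁ ^ 2 + 4 * a₂) ^ 2 - 24 * (2 * a₄ + a₁ * a₃) ∧
      c6 = -(a₁ ^ 2 + 4 * a₂) ^ 3 + 36 * (a₁ ^ 2 + 4 * a₂) * (2 * a₄ + a₁ * a₃) - 216 * (a₃ ^ 2 + 4 * a₆) ∧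
      (3 : ℤ) ^ ν * Dp = -(a₁ ^ 2 + 4 * a₂) ^ 2 * (a₁ ^ 2 * a₆ + 4 * a₂ * a₆ - a₁ * a₃ * a₄ + a₂ * a₃ ^ 2 - a₄ ^ 2) -
        8 * (2 * a₄ + a₁ * a₃) ^ 3 - 27 * (a₃ ^ 2 + 4 * a₆) ^ 2 +
        9 * (a₁ ^ 2 + 4 * a₂) * (2 * a₄ + a₁ * a₃) * (a₃ ^ 2 + 4 * a₆) ∧
      ¬ (3 : ℤ) ∣ c4 ∧ ¬ (3 : ℤ) ∣ Dp ∧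
      U = Dp * c4 ^ 3 + 744 * (3 : ℤ) ^ ν * Dp ^ 2 ∧ NL = U ^ 2 - c4 ^ 12 ∧
      NL = (3 : ℤ) ^ vL * nL ∧ ¬ (3 : ℤ) ∣ nL ∧ 1 ≤ vL ∧ vL + 1 ≤ 2 * ν ∧
      α + vL = 2 * k ∧ (3 : ℤ) ^ α * m = a ^ 2 - 1 ∧
      ¬ (3 : ℤ) ∣ m * b ^ 2 * c4 * nL + a ^ 2 * (e' : ℤ) ^ 2 * c6)
    {x y : ℚ} (hx : x = a / ((3 ^ k * e' : ℕ) : ℚ) ^ 2) (hy : y = b / ((3 ^ k * e' : ℕ) : ℚ) ^ 3)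
    (hP : W.toAffine.Equation x y)
    {q : ℚ_[3]} (hq0 : q ≠ 0) (hq : ‖q‖ < 1) (hj : tateJ q = (W.j : ℚ_[3])) :
    heightSplitCoord W 3 q x y ≠ 0 := by
  obtain ⟨hpe', hk, hcop, hpb, hc4, hc6, hD, hpc4, hpDp, hU, hNL, hnL, hpnL, hvL1, hvL, hαk, hm, hcrit⟩ := H
  have hp1 : (1 : ℝ) < (3 : ℕ) := by norm_num
  have hpR : (0 : ℝ) < (3 : ℕ) := by norm_num
  have hp0 : ((3 : ℕ) : ℚ_[3]) ≠ 0 := by norm_num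
  have he'0 : e' ≠ 0 := by rintro rfl; exact hpe' (dvd_zero 3)
  have he0 : (3 ^ k * e' : ℕ) ≠ 0 := Nat.mul_ne_zero (pow_ne_zero _ (by norm_num)) he'0
  have hpe : 3 ∣ 3 ^ k * e' := dvd_mul_of_dvd_left (dvd_pow_self 3 (by omega)) _
  have h : W.toAffine.Nonsingular x y :=
    (WeierstrassCurve.Affine.equation_iff_nonsingular (W := W.toAffine)).mp hP
  have hx1 : 1 < ‖(x : ℚ_[3])‖ :=
    (one_lt_norm_ratCast_iff 3 x).mpr (KernelCert.padicValRat_x_neg he0 hx hcop hpe)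
  have hbn : ‖(b : ℚ_[3])‖ = 1 := BinaryQuartic.norm_intCast_eq_one (by exact_mod_cast hpb)
  have hc4n : ‖(c4 : ℚ_[3])‖ = 1 := BinaryQuartic.norm_intCast_eq_one (by exact_mod_cast hpc4)
  have hnLn : ‖(nL : ℚ_[3])‖ = 1 := BinaryQuartic.norm_intCast_eq_one (by exact_mod_cast hpnL)
  have hb0 : (b : ℚ_[3]) ≠ 0 := norm_pos_iff.mp (by rw [hbn]; exact one_pos)
  have hc40 : (c4 : ℚ_[3]) ≠ 0 := norm_pos_iff.mp (by rw [hc4n]; exact one_pos)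
  have hnL0 : (nL : ℚ_[3]) ≠ 0 := norm_pos_iff.mp (by rw [hnLn]; exact one_pos)
  have he'Q0 : (e' : ℚ_[3]) ≠ 0 := by exact_mod_cast he'0
  set E : ℕ := 3 ^ k * e' with hEdef
  have hcop2 : Nat.Coprime a.natAbs (((E : ℤ) ^ 2).natAbs) := by
    rw [Int.natAbs_pow, Int.natAbs_natCast]; exact hcop.pow_right 2
  have hE2pos : (0 : ℤ) < (E : ℤ) ^ 2 := by positivity
  have hxq : x = ((a : ℤ) : ℚ) / (((E : ℤ) ^ 2 : ℤ) : ℚ) := by rw [hx]; push_cast; ring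
  have hnum : x.num = a := by rw [hxq]; exact Rat.num_div_eq_of_coprime hE2pos hcop2
  have hWc4 : (W.c₄ : ℚ_[3]) = (c4 : ℚ_[3]) := by
    have : W.c₄ = (c4 : ℚ) := by
      subst hW; rw [hc4]; simp only [WeierstrassCurve.c₄, WeierstrassCurve.b₂, WeierstrassCurve.b₄]; push_cast; ring
    rw [this]; push_cast; rfl
  have hWc6 : (W.c₆ : ℚ_[3]) = (c6 : ℚ_[3]) := by
    have : W.c₆ = (c6 : ℚ) := by
      subst hW; rw [hc6]
      simp only [WeierstrassCurve.c₆, WeierstrassCurve.b₂, WeierstrassCurve.b₄, WeierstrassCurve.b₆]; push_cast; ring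
    rw [this]; push_cast; rfl
  have hNLn : ‖(NL : ℚ_[3])‖ = ((3 : ℕ) : ℝ) ^ (-(vL : ℤ)) := by
    rw [hnL]; push_cast
    rw [norm_mul, norm_pow, show (3 : ℚ_[3]) = ((3 : ℕ) : ℚ_[3]) by norm_cast, Padic.norm_p, hnLn, mul_one,
      ← zpow_natCast, inv_zpow']
    norm_num
  have hNL0 : (NL : ℚ_[3]) ≠ 0 := norm_pos_iff.mp (by rw [hNLn]; positivity)
  have hNL' : NL = U ^ (3 - 1) - c4 ^ (6 * (3 - 1)) := by rw [hNL]
  have hL := norm_padicLog_tateParam_add_intCast_le (p := 3) (by norm_num) W hW hc4 (by exact_mod_cast hD)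
    (by exact_mod_cast hpc4) (by exact_mod_cast hpDp) (by rw [hU]; push_cast; ring) hNL' (by rw [hnL]; push_cast; ring)
    (by exact_mod_cast hpnL) hvL hq0 hq hj
  have hlaw := norm_heightFourOneCoord_sub_padicLog_num_le hWm hq h hx1
  have htwo := norm_heightSplitCoord_add_add_le (p := 3) (by norm_num) hWm hq h hx1 hlaw hNL0 hL
  set t : ℚ_[3] := (a : ℚ_[3]) ^ 2 * (e' : ℚ_[3]) ^ 2 * (c6 : ℚ_[3]) / ((b : ℚ_[3]) ^ 2 * (c4 : ℚ_[3]) * (nL : ℚ_[3]))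
    with ht
  have hAeq : (((x.num : ℚ) : ℚ_[3])) ^ (3 - 1) - 1 = ((3 : ℕ) : ℚ_[3]) ^ α * (m : ℚ_[3]) := by
    rw [hnum, Rat.cast_intCast]; push_cast; exact_mod_cast hm.symm
  have hT0eq : (-(x : ℚ_[3]) / y) ^ 2 * ((W.c₆ : ℚ_[3]) / (W.c₄ : ℚ_[3])) / (NL : ℚ_[3]) =
      ((3 : ℕ) : ℚ_[3]) ^ α * t := by
    have hxQ : (x : ℚ_[3]) = (a : ℚ_[3]) / ((3 : ℚ_[3]) ^ k * (e' : ℚ_[3])) ^ 2 := by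
      rw [hx, hEdef]; push_cast; ring
    have hyQ : ((y : ℚ) : ℚ_[3]) = (b : ℚ_[3]) / ((3 : ℚ_[3]) ^ k * (e' : ℚ_[3])) ^ 3 := by
      rw [hy, hEdef]; push_cast; ring
    have h2k : (3 : ℚ_[3]) ^ (2 * k) = (3 : ℚ_[3]) ^ α * (3 : ℚ_[3]) ^ vL := by rw [← pow_add, hαk]
    rw [hWc4, hWc6, hnL, hxQ, hyQ, ht]; push_cast
    field_simp
    rw [show ((3 : ℚ_[3]) ^ k) ^ 2 = (3 : ℚ_[3]) ^ α * (3 : ℚ_[3]) ^ vL from by rw [← pow_mul, mul_comm, h2k]]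
    ring
  have htn : ‖t‖ ≤ 1 := by
    rw [ht, norm_div, norm_mul, norm_mul, norm_mul, norm_mul, norm_pow, norm_pow, norm_pow, hbn, hc4n, hnLn]
    simp only [one_pow, mul_one, div_one]
    have ha := Padic.norm_int_le_one (p := 3) a
    have he := Padic.norm_int_le_one (p := 3) (e' : ℤ)
    have hc := Padic.norm_int_le_one (p := 3) c6
    push_cast at he
    calc ‖(a : ℚ_[3])‖ ^ 2 * ‖(e' : ℚ_[3])‖ ^ 2 * ‖(c6 : ℚ_[3])‖ ≤ 1 ^ 2 * 1 ^ 2 * 1 := by gcongr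
      _ = 1 := by norm_num
  have hpα : ‖((3 : ℕ) : ℚ_[3]) ^ α‖ = ((3 : ℕ) : ℝ) ^ (-(α : ℤ)) := by
    rw [norm_pow, Padic.norm_p, ← zpow_natCast, inv_zpow']
  have herr : ‖heightSplitCoord W 3 q x y + ((3 : ℕ) : ℚ_[3]) ^ α * (m : ℚ_[3]) + ((3 : ℕ) : ℚ_[3]) ^ α * t‖ ≤
      ((3 : ℕ) : ℝ) ^ (-((α : ℤ) + 1)) := by
    rw [hAeq, hT0eq] at htwo
    have hpow1 : ((3 : ℕ) : ℝ) ^ (-((α : ℤ) + 1)) = ((3 : ℕ) : ℝ)⁻¹ * (((3 : ℕ) : ℝ) ^ (-(α : ℤ)) * 1) := by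
      rw [mul_one, neg_add, zpow_add₀ hpR.ne', zpow_neg_one, mul_comm]
    refine htwo.trans (max_le ?_ (max_le ?_ ?_))
    · rw [norm_mul, hpα, hpow1]
      gcongr
      exact Padic.norm_int_le_one _
    · rw [norm_mul, hpα, hpow1]
      gcongr
    · have he'n : ‖(e' : ℚ_[3])‖ = 1 := by
        rw [show (e' : ℚ_[3]) = ((e' : ℤ) : ℚ_[3]) by norm_cast]
        exact BinaryQuartic.norm_intCast_eq_one (fun hd => hpe' (by exact_mod_cast hd))
      have hpa : ¬ ((3 : ℕ) : ℤ) ∣ a := by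
        intro hd
        have h1' : 3 ∣ a.natAbs := Int.natCast_dvd.mp hd
        have h2' : 3 ∣ Nat.gcd a.natAbs (3 ^ k * e') := Nat.dvd_gcd h1' hpe
        rw [hcop] at h2'
        omega
      have hxinv : ‖(x : ℚ_[3])‖⁻¹ = ((3 : ℕ) : ℝ) ^ (-((2 * k : ℕ) : ℤ)) := by
        have hxp : (x : ℚ_[3]) = (a : ℚ_[3]) / (((3 : ℕ) : ℚ_[3]) ^ k * (e' : ℚ_[3])) ^ 2 := by
          rw [hx, hEdef]; push_cast; ring
        rw [hxp, norm_div, BinaryQuartic.norm_intCast_eq_one hpa, norm_pow, norm_mul, norm_pow, Padic.norm_p, he'n,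
          mul_one, one_div, inv_inv, ← zpow_natCast, ← zpow_natCast, ← zpow_mul, inv_zpow']
        congr 1; push_cast; ring
      rw [hxinv]
      exact zpow_le_zpow_right₀ hp1.le (by push_cast; omega)
  have hmain : ‖((3 : ℕ) : ℚ_[3]) ^ α * (m : ℚ_[3]) + ((3 : ℕ) : ℚ_[3]) ^ α * t‖ = ((3 : ℕ) : ℝ) ^ (-(α : ℤ)) := by
    have e : ((3 : ℕ) : ℚ_[3]) ^ α * (m : ℚ_[3]) + ((3 : ℕ) : ℚ_[3]) ^ α * t =
        ((3 : ℕ) : ℚ_[3]) ^ α * (((m * b ^ 2 * c4 * nL + a ^ 2 * (e' : ℤ) ^ 2 * c6 : ℤ) : ℚ_[3]) /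
          ((b : ℚ_[3]) ^ 2 * (c4 : ℚ_[3]) * (nL : ℚ_[3]))) := by
      rw [ht]; push_cast; field_simp
    rw [e, norm_mul, hpα, norm_div, BinaryQuartic.norm_intCast_eq_one (by exact_mod_cast hcrit), norm_mul, norm_mul,
      norm_pow, hbn, hc4n, hnLn]
    norm_num
  intro h0
  have hsum : heightSplitCoord W 3 q x y + ((3 : ℕ) : ℚ_[3]) ^ α * (m : ℚ_[3]) + ((3 : ℕ) : ℚ_[3]) ^ α * t =
      ((3 : ℕ) : ℚ_[3]) ^ α * (m : ℚ_[3]) + ((3 : ℕ) : ℚ_[3]) ^ α * t := by rw [h0, zero_add]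
  rw [hsum, hmain] at herr
  have : ((3 : ℕ) : ℝ) ^ (-(α : ℤ)) > ((3 : ℕ) : ℝ) ^ (-((α : ℤ) + 1)) := zpow_lt_zpow_right₀ hp1 (by omega)
  exact absurd herr (not_le.mpr this)

/-- **`RegMult.CertSplit W 3 Q 1` from the `p = 3` digit checker** (+ gcd admissibility test). ONE curve per application.
[cite: SteinWuthrich2013, §4.2] [cite: SilvermanAEC2009, VII.2.1] [cite: MazurSteinTate2006, §1] -/
theorem certSplit_of_digitRow_three (W : WeierstrassCurve ℚ) {a₁ a₂ a₃ a₄ a₆ : ℤ}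
    (hW : W = ⟨a₁, a₂, a₃, a₄, a₆⟩) [W.IsElliptic] [W.IsGloballyMinimal] (hWm : Mult W 3)
    {a b c4 c6 Dp U NL nL m : ℤ} {e' k n ν vL α : ℕ}
    (Hg : Int.gcd (2 * b + a₁ * a * (3 ^ k * e' : ℕ) + a₃ * (3 ^ k * e' : ℕ) ^ 3)
        (a₁ * b * (3 ^ k * e' : ℕ) - (3 * a ^ 2 + 2 * a₂ * a * (3 ^ k * e' : ℕ) ^ 2 + a₄ * (3 ^ k * e' : ℕ) ^ 4))
        ∣ (3 ^ k * e') ^ n)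
    (H : ¬ 3 ∣ e' ∧ 1 ≤ k ∧ Nat.Coprime a.natAbs (3 ^ k * e') ∧ ¬ (3 : ℤ) ∣ b ∧
      c4 = (a₁ ^ 2 + 4 * a₂) ^ 2 - 24 * (2 * a₄ + a₁ * a₃) ∧
      c6 = -(a₁ ^ 2 + 4 * a₂) ^ 3 + 36 * (a₁ ^ 2 + 4 * a₂) * (2 * a₄ + a₁ * a₃) - 216 * (a₃ ^ 2 + 4 * a₆) ∧
      (3 : ℤ) ^ ν * Dp = -(a₁ ^ 2 + 4 * a₂) ^ 2 * (a₁ ^ 2 * a₆ + 4 * a₂ * a₆ - a₁ * a₃ * a₄ + a₂ * a₃ ^ 2 - a₄ ^ 2) -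
        8 * (2 * a₄ + a₁ * a₃) ^ 3 - 27 * (a₃ ^ 2 + 4 * a₆) ^ 2 +
        9 * (a₁ ^ 2 + 4 * a₂) * (2 * a₄ + a₁ * a₃) * (a₃ ^ 2 + 4 * a₆) ∧
      ¬ (3 : ℤ) ∣ c4 ∧ ¬ (3 : ℤ) ∣ Dp ∧
      U = Dp * c4 ^ 3 + 744 * (3 : ℤ) ^ ν * Dp ^ 2 ∧ NL = U ^ 2 - c4 ^ 12 ∧
      NL = (3 : ℤ) ^ vL * nL ∧ ¬ (3 : ℤ) ∣ nL ∧ 1 ≤ vL ∧ vL + 1 ≤ 2 * ν ∧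
      α + vL = 2 * k ∧ (3 : ℤ) ^ α * m = a ^ 2 - 1 ∧
      ¬ (3 : ℤ) ∣ m * b ^ 2 * c4 * nL + a ^ 2 * (e' : ℤ) ^ 2 * c6)
    {x y : ℚ} (hx : x = a / ((3 ^ k * e' : ℕ) : ℚ) ^ 2) (hy : y = b / ((3 ^ k * e' : ℕ) : ℚ) ^ 3)
    (h : W.toAffine.Nonsingular x y) :
    RegMult.CertSplit W 3 (.some x y h) 1 := by
  have he'0 : e' ≠ 0 := by rintro rfl; exact H.1 (dvd_zero 3)
  have he0 : (3 ^ k * e' : ℕ) ≠ 0 := Nat.mul_ne_zero (pow_ne_zero _ (by norm_num)) he'0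
  have hpe : 3 ∣ 3 ^ k * e' := dvd_mul_of_dvd_left (dvd_pow_self 3 (by have := H.2.1; omega)) _
  have hx1 : 1 < ‖(x : ℚ_[3])‖ :=
    (one_lt_norm_ratCast_iff 3 x).mpr (KernelCert.padicValRat_x_neg he0 hx H.2.2.1 hpe)
  have hadm : W.IsAdmissible 3 (.some x y h) :=
    isAdmissible_of_one_lt_norm (by norm_num) h hx1
      (KernelCert.hasNonsingularReductionAt_of_gcd W hW he0 hx hy H.2.2.1 Hg)
  refine ⟨by rw [one_nsmul]; exact hadm, fun Dq => ?_⟩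
  rw [one_nsmul]
  show heightSplitCoord W 3 Dq.q x y ≠ 0
  exact heightSplitCoord_ne_zero_of_digitRow_three W hW hWm H hx hy h.left Dq.q_ne_zero Dq.norm_q_lt_one Dq.tateJ_eq

end DigitThree

/-! ### §13 Two digit rows of record at `3` -/

section Rows

/-- **Cremona `170034b1` at the split prime `3` — a DIGIT row** (`[1,0,1,-156,346]`, `N = 170034`, type
`I_1` at `3`): lane A's tabulated point `Q = 2·P = (106/9, 193/27)` (`P = (-2, 26)`, REG3CERT/v2 row
`170034b1@3`) has `k = 1`, `v_L = 1`, `α = 2k − v_L = 1 = v₃(a² − 1)` — the valuation criterion is SILENT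
(`α + v_L = 2k`) — and the digit `m·b²c₄n_L + a²e'²c₆ ≢ 0 (mod 3)` decides: **`RegMult.CertSplit W 3 Q 1`**
(`‖ĥ₃^{split}(Q)‖₃ = 3^{−1}`; lane A's 48-digit value has `v₃ = 1`). ONE curve; nothing class-wide.
[cite: SteinWuthrich2013, §4.2] [cite: Cremona1997, Table 1 (curve 170034b1)] -/
theorem certSplit_170034b1 (W : WeierstrassCurve ℚ) (hW : W = ⟨1, 0, 1, -156, 346⟩) [W.IsElliptic]
    [W.IsGloballyMinimal] :
    ∃ h : W.toAffine.Nonsingular ((106 : ℚ) / 9) ((193 : ℚ) / 27), RegMult.CertSplit W 3 (.some _ _ h) 1 := by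
  have hP : W.toAffine.Equation ((106 : ℚ) / 9) ((193 : ℚ) / 27) := by
    subst hW; rw [WeierstrassCurve.Affine.equation_iff]; norm_num
  refine ⟨(WeierstrassCurve.Affine.equation_iff_nonsingular (W := W.toAffine)).mp hP, ?_⟩
  exact certSplit_of_digitRow_three W hW (mult_three_of_model W hW (c4 := 7465) (D := 184996992) (by norm_num))
    (a := 106) (b := 193) (c4 := 7465) (c6 := -310357) (Dp := 61665664) (U := 34140210176112575872) (NL := -29947303766771868576906712455409675920693830241)
    (nL := -9982434588923956192302237485136558640231276747) (m := 3745) (e' := 1) (k := 1) (n := 0) (ν := 1) (vL := 1) (α := 1)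
    (by norm_num) (by norm_num) (by norm_num) (by norm_num) _

/-- **Cremona `438510e1` at the split prime `3` — a DIGIT row** (`[1,0,1,-4184,103802]`, `N = 438510`, type
`I_1` at `3`): lane A's tabulated point `Q = 2·P = (340/9, -673/27)` (`P = (23, 129)`, REG3CERT/v2 row
`438510e1@3`) has `k = 1`, `v_L = 1`, `α = 2k − v_L = 1 = v₃(a² − 1)` — the valuation criterion is SILENT
(`α + v_L = 2k`) — and the digit `m·b²c₄n_L + a²e'²c₆ ≢ 0 (mod 3)` decides: **`RegMult.CertSplit W 3 Q 1`**
(`‖ĥ₃^{split}(Q)‖₃ = 3^{−1}`; lane A's 48-digit value has `v₃ = 1`). ONE curve; nothing class-wide.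
[cite: SteinWuthrich2013, §4.2] [cite: Cremona1997, Table 1 (curve 438510e1)] -/
theorem certSplit_438510e1 (W : WeierstrassCurve ℚ) (hW : W = ⟨1, 0, 1, -4184, 103802⟩) [W.IsElliptic]
    [W.IsGloballyMinimal] :
    ∃ h : W.toAffine.Nonsingular ((340 : ℚ) / 9) ((-673 : ℚ) / 27), RegMult.CertSplit W 3 (.some _ _ h) 1 := by
  have hP : W.toAffine.Equation ((340 : ℚ) / 9) ((-673 : ℚ) / 27) := by
    subst hW; rw [WeierstrassCurve.Affine.equation_iff]; norm_num
  refine ⟨(WeierstrassCurve.Affine.equation_iff_nonsingular (W := W.toAffine)).mp hP, ?_⟩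
  exact certSplit_of_digitRow_three W hW (mult_three_of_model W hW (c4 := 200809) (D := -41219940) (by norm_num))
    (a := 340) (b := -673) (c4 := 200809) (c6 := -89986357) (Dp := -13739980) (U := -111258698694191417264620) (NL := -4299303270797828158102337754428234381986966497246827875737878481)
    (nL := -1433101090265942719367445918142744793995655499082275958579292827) (m := 38533) (e' := 1) (k := 1) (n := 0) (ν := 1) (vL := 1) (α := 1)
    (by norm_num) (by norm_num) (by norm_num) (by norm_num) _

end Rows

end Summit.BirchSwinnertonDyer.Rank1Residual.X11b.RegMult.HeightLogNumerator

end
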